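/-
Origin: expansion seat `literature-prover-pub-hodgecm-cf-kudla-howe-rallis-g7-0`, handover cf-kudla-howe-rallis-g7 ; 2026-08-18T15:09:41Z (`HOME/pub-hodgecm-cf-kudla-howe-rallis-g7/lean/CfKHRg7/ArchThetaSignature.lean`, md5 ab583558, 77 lines);
landed by the gen-8 packager in gate run 31 as `HodgeCM/Literature/ArchThetaSignature.lean` (verbatim).
-/
/-
Copyright (c) 2026 the pub-hodgecm formalisation cell (harness21).  New file, not vendored.
Origin: HOME/pub-hodgecm-cf-kudla-howe-rallis-g7/lean/CfKHRg7/ArchThetaSignature.lean — session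
literature-prover-pub-hodgecm-cf-kudla-howe-rallis-g7-0 (unit pub-hodgecm-cf-kudla-howe-rallis-g7, CITED-FACT seat (4) theta, gen 7).
Intended final place: `HodgeCM/Literature/ArchThetaSignature.lean` (NEW additive leaf, STAGING for the tree import under the
LEAN-IN-TREE rule; imports the landed `HodgeCM.Literature.ThetaLiftExhaustion` (cf-rogawski, runs 21/29) + Mathlib; no WIP import,
no rewrite).  Requested by prl2-g8 (STATUS 14:57:09Z "prl2 imports ArchThetaSignature", consumer `StubTree/SignMatchArch.lean`).
Companion prose: HOME/CITED-FACTS.md § pub-hodgecm-cf-kudla-howe-rallis-g7, KHR-40 P1 / KHR-48.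
-/
import Mathlib
import Summits.HodgeConjecture.HodgeCM.Literature.ThetaLiftExhaustion

set_option autoImplicit false

/-!
# Cited: the archimedean signature of a theta lift to `U(p,q)` — [BMM16] Acta Math. 216 (2016), proof of Thm 7.2, p. 66 (→ [Paul98])

AS PRINTED (Bergeron–Millson–Moeglin, *The Hodge conjecture and arithmetic quotients of complex balls*, Acta Math. 216 (2016) 1–125,
end of the proof of Theorem 7.2, printed p. 66 = Project-Euclid PDF p0070 L1–L4, store key `paper:url-74f0819951c5`; = arXiv:1306.1515v3
proof of Thm 7.8, chunk p0034 L40 of `paper:arxiv-1306.1515`): "The only remaining thing to be proved is that the signature at infinity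
is `(a,b)` [arXiv] / … that `U(V)(F_v) ≅ U(p,q)`, the signature of `W` is `(a,b)`.  But this follows from the explicit description of the
Archimedean theta correspondence obtained by Annegret Paul [61]: the cohomological representation `A(b×q, a×q)` is the image of the local
theta correspondence from a group `U(W, ℂ/ℝ)` with `dim W = a+b` if and only if the signature of `W` is `(a,b)`."  [61] = A. Paul, *Howe
correspondence for real unitary groups*, J. Funct. Anal. 159 (1998) 384–431 (held, `paper:doi-10-1006-jfan-1998-3330`; its Thm 0.1, p. 386,
is the EQUAL-RANK case `r+s = p+q`).

TYPING: over cf-rogawski's carriers `BMMSpectrum` (`CohInf` = `Coh_∞`, `A b a` = `A(b×q,a×q)`) extended by ONE local carrier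
`IsLocalThetaLiftFrom π_∞ (a',b')` = "`π_∞` is the image of the local theta correspondence from a group `U(W, ℂ/ℝ)` of signature `(a',b')`"
(so `dim W = a'+b'`).  The sentence is the `Prop` `ArchSignature`: for all `a b a' b'` with `a'+b' = a+b`,
`IsLocalThetaLiftFrom (A b a) (a',b') ↔ (a',b') = (a,b)`.  Context of the sentence in print: `U(V)(F_{v₀}) ≅ U(p,q)`, `m = p+q`, inside
the proof of Thm 7.2 (hypothesis `3(a+b)+|a−b| < 2m`); the typed form keeps that hypothesis as `X.degreeBound a b`.
PerL v5 USE: `(p,q) = (2,1)`, `a+b = 1`: holomorphic one-form classes (`H^{b×q,a×q}`, `{a,b} = {0,1}`) are theta lifts from hermitian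
LINES of ONE signature — the ι₁ half of prl2-g7's `BMMDict.SignMatch` (`StubTree/ThetaSpanFromBMM.lean`); K̃′-type form: Adams 2007
Prop 6.6 at `(p;m,n) = (1;2,1), (1;1,2)` (typed, `UpUmnTheta.Adams_Prop_6_6`).  MISMATCH: none; which of `(0,1)`, `(1,0)` is PerL's
`ε_hol` is the Hodge-type convention of [BMM] §6.8 / §1.5 (left to the datum, as in `BMMSpectrum.thm78_degree_one`).
-/

noncomputable section

namespace HodgeCM.Literature.BMM

/-- [BMM16] carriers + the LOCAL theta-image predicate at the real place `v₀` with `U(V)(F_{v₀}) ≅ U(p,q)`. -/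
structure BMMArchSpectrum extends BMMSpectrum where
  /-- `π_∞` is the image of the local theta correspondence from `U(W, ℂ/ℝ)`, `W` of signature `(a',b')` -/
  IsLocalThetaLiftFrom : toBMMSpectrum.CohInf → ℕ × ℕ → Prop

namespace BMMArchSpectrum

variable (X : BMMArchSpectrum)

/-- P. **[BMM16] proof of Thm 7.2, Acta p. 66 (→ [Paul98])**, AS PRINTED above: for `3(a+b)+|a−b| < 2m`, the cohomological representation
`A(b×q, a×q)` is the image of the local theta correspondence from `U(W, ℂ/ℝ)` with `dim W = a+b` iff the signature of `W` is `(a,b)`.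
[cite: BMM16, Acta Math. 216 (2016) p. 66 (proof of Thm 7.2); Paul, J. Funct. Anal. 159 (1998)] -/
def ArchSignature : Prop :=
  ∀ (a b a' b' : ℕ), X.degreeBound a b → a' + b' = a + b →
    (X.IsLocalThetaLiftFrom (X.A b a) (a', b') ↔ (a', b') = (a, b))

/-- DERIVED (degree one, `m ≥ 3`): `A(1×q, 0×q)` is a local theta lift from a LINE of signature `(a',b')` iff `(a',b') = (0,1)`, and
`A(0×q, 1×q)` iff `(a',b') = (1,0)` — lines of the two signatures feed the two conjugate Hodge types, never the same one. -/
theorem archSignature_degree_one (h : X.ArchSignature) (hm : 3 ≤ X.m) {a' b' : ℕ} (hab : a' + b' = 1) :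
    (X.IsLocalThetaLiftFrom (X.A 1 0) (a', b') ↔ (a', b') = (0, 1)) ∧
    (X.IsLocalThetaLiftFrom (X.A 0 1) (a', b') ↔ (a', b') = (1, 0)) :=
  ⟨h 0 1 a' b' (X.degreeBound_of_add_eq_one (by norm_num) hm) (by omega),
   h 1 0 a' b' (X.degreeBound_of_add_eq_one (by norm_num) hm) (by omega)⟩

/-- DERIVED: a line of signature `(1,0)` does NOT lift to `A(1×q, 0×q)` (and symmetrically). -/
theorem not_isLocalThetaLiftFrom_A10_of_sig10 (h : X.ArchSignature) (hm : 3 ≤ X.m) :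
    ¬ X.IsLocalThetaLiftFrom (X.A 1 0) (1, 0) := by
  intro hl
  have := ((X.archSignature_degree_one h hm (a' := 1) (b' := 0) rfl).1).1 hl
  simp at this

end BMMArchSpectrum

end HodgeCM.Literature.BMM

end
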